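import Literature.Analysis.FluidPDE.OseenMildHolder
import Literature.Analysis.FluidPDE.MildSolution
import Literature.Analysis.FluidPDE.SelfSimilar
import Literature.Analysis.FluidPDE.OseenKernelLineIntegrals
import HarnessLib

/-!
# Crux `FiniteTangentModuliMild` (stmt-NavierStokesRegularity-14049), line `packing-observability`: STUB 3

Uniform modulus of continuity, on the window cylinder `Q_R = [−2,−1] × B̄_R`, of smooth tempered fields
obeying the LINEARISED Oseen identity about a Type-I drift — the registered stub `stub_equicontinuous`
of the line's skeleton (`Cruxes/FiniteTangentModuliMild/Lines/packing-observability.lean`). Helper file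
for the crux item (lands `--supports stmt-NavierStokesRegularity-14049`). Everything proved; the proof is
that of `OseenMildHolder.exists_holder_quarter_of_oseenMild` (KNSS 2009, Lemma 4.1 / 6.1) run on the
linearised identity `v(t) = e^{(t−s)Δ}v(s) − ∫ₛᵗ∫ (K(t−τ,x−y)[u,v] + K(t−τ,x−y)[v,u]) dy dτ`:

* `exists_norm_integral_oseenKernel_symm_le`: the symmetrised Duhamel term of fields bounded by `M₁`,
  `M₂` on `(s,t) × E` is `≤ c M₁ M₂ · 2√(t−s)` (Koch–Tataru's kernel bound integrated in `y`, then in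
  `τ`, through `‖∫ f‖ₑ ≤ ∫⁻ ‖f‖ₑ` twice — no measurability needed);
* `restart_space_time_moduli`, `exists_holder_quarter_of_heat_restart`: the `1/4`-Hölder modulus for an
  ABSTRACT restart identity `u(t) = e^{(t−s)Δ}u(s) − N_s(t)`, `‖N_s(t)‖ ≤ L√(t−s)`:
  `‖u(t',x') − u(t,x)‖ ≤ K₀ (m + L) δ^{1/4}` on `[a+1, b]` for slices continuous and bounded by `m`;
* `stub_equicontinuous`: on `[−3,−1] × ℝ³` the drift is bounded by `C` and the field by `2K`, so
  `L = 4cCK`, `m = 2K`, and the modulus is `K · K₀(2 + 4cC) δ^{1/4} =: K ω(δ)`.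
-/

noncomputable section

open Set Function Filter Topology Metric MeasureTheory
open Literature.Analysis Literature.Analysis.FluidPDE

set_option linter.dupNamespace false

namespace Summit.NavierStokesRegularity.NavierStokesRegularity.Theorems

/-- Local notation for physical space `ℝ³ = EuclideanSpace ℝ (Fin 3)` (as in the registered skeleton). -/
local notation "ℝ³" => EuclideanSpace ℝ (Fin 3)

variable {E : Type*} [NormedAddCommGroup E] [InnerProductSpace ℝ E] [FiniteDimensional ℝ E]
  [MeasurableSpace E] [BorelSpace E]

/-! ### The symmetrised Duhamel term of bounded fields -/

/-- **Sup bound for the symmetrised Oseen Duhamel term of bounded fields** (KNSS 2009, §4 p. 8,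
`‖B(u,v)‖_∞ ≤ C√T‖u‖_∞‖v‖_∞`): there is `C = C(E) > 0` such that for `u` bounded by `M₁` and `v` bounded
by `M₂` on `(s,t) × E`, `‖∫_{(s,t)}∫ (K(t−τ,x−y)[u,v] + K(t−τ,x−y)[v,u]) dy dτ‖ ≤ C M₁ M₂ · 2√(t−s)`
(Bochner integrals, junk values covered: `‖∫ f‖ₑ ≤ ∫⁻ ‖f‖ₑ` twice, then the kernel bound
`|K(τ,z)[a,b]| ≤ c (τ + |z|²)^{-(d+1)/2}|a||b|`). Adapted from `exists_norm_oseenDuhamel_bounded_le`. -/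
theorem exists_norm_integral_oseenKernel_symm_le :
    ∃ C : ℝ, 0 < C ∧ ∀ {u v : ℝ → E → E} {s t M₁ M₂ : ℝ}, s < t → 0 ≤ M₁ → 0 ≤ M₂ →
      (∀ τ ∈ Ioo s t, ∀ y, ‖u τ y‖ ≤ M₁) → (∀ τ ∈ Ioo s t, ∀ y, ‖v τ y‖ ≤ M₂) → ∀ x : E,
        ‖∫ τ in Ioo s t, ∫ y, (oseenKernel (t - τ) (x - y) (u τ y) (v τ y) +
            oseenKernel (t - τ) (x - y) (v τ y) (u τ y))‖ ≤ C * (M₁ * M₂) * (2 * Real.sqrt (t - s)) := by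
  set d : ℝ := (Module.finrank ℝ E : ℝ) with hd
  obtain ⟨C₀, hC₀, hK⟩ := exists_norm_oseenKernel_le (E := E)
  set I : ℝ := ∫ w : E, (1 + ‖w‖ ^ 2) ^ (-((d + 1) / 2)) with hI
  have he : d < 2 * ((d + 1) / 2) := by linarith
  have hI0 : 0 < I := integral_one_add_norm_sq_rpow_neg_pos he
  refine ⟨2 * C₀ * I, by positivity, fun {u v s t M₁ M₂} hst hM₁ hM₂ hu hv x => ?_⟩
  have hnn : 0 ≤ 2 * C₀ * I * (M₁ * M₂) * (2 * Real.sqrt (t - s)) := by positivity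
  rw [← ENNReal.ofReal_le_ofReal_iff hnn, ofReal_norm]
  refine le_trans (enorm_integral_le_lintegral_enorm _)
    (le_trans (lintegral_mono fun τ => enorm_integral_le_lintegral_enorm _) ?_)
  have hscal : d / 2 - (d + 1) / 2 = -(1 / 2 : ℝ) := by ring
  -- the slice bound
  have hslice : ∀ τ ∈ Ioo s t,
      ∫⁻ y, ‖oseenKernel (t - τ) (x - y) (u τ y) (v τ y) + oseenKernel (t - τ) (x - y) (v τ y) (u τ y)‖ₑ ≤
        ENNReal.ofReal (2 * C₀ * (M₁ * M₂) * I * (t - τ) ^ (-(1 / 2 : ℝ))) := by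
    intro τ hτ
    have hσ : 0 < t - τ := sub_pos.2 hτ.2
    calc ∫⁻ y, ‖oseenKernel (t - τ) (x - y) (u τ y) (v τ y) + oseenKernel (t - τ) (x - y) (v τ y) (u τ y)‖ₑ
        ≤ ∫⁻ y, ENNReal.ofReal (2 * C₀ * (M₁ * M₂)) *
            ENNReal.ofReal ((t - τ + ‖x - y‖ ^ 2) ^ (-((d + 1) / 2))) := by
          refine lintegral_mono fun y => ?_
          rw [← ofReal_norm, ← ENNReal.ofReal_mul (by positivity)]
          refine ENNReal.ofReal_le_ofReal ?_
          have hb : C₀ * (t - τ + ‖x - y‖ ^ 2) ^ (-((d + 1) / 2)) * ‖u τ y‖ * ‖v τ y‖ ≤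
              C₀ * (t - τ + ‖x - y‖ ^ 2) ^ (-((d + 1) / 2)) * M₁ * M₂ := by
            gcongr
            · exact hu τ hτ y
            · exact hv τ hτ y
          calc ‖oseenKernel (t - τ) (x - y) (u τ y) (v τ y) + oseenKernel (t - τ) (x - y) (v τ y) (u τ y)‖
              ≤ ‖oseenKernel (t - τ) (x - y) (u τ y) (v τ y)‖ +
                  ‖oseenKernel (t - τ) (x - y) (v τ y) (u τ y)‖ := norm_add_le _ _
            _ ≤ C₀ * (t - τ + ‖x - y‖ ^ 2) ^ (-((d + 1) / 2)) * M₁ * M₂ +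
                  C₀ * (t - τ + ‖x - y‖ ^ 2) ^ (-((d + 1) / 2)) * M₁ * M₂ := by
                refine add_le_add ((hK hσ (x - y) _ _).trans hb) ((hK hσ (x - y) _ _).trans ?_)
                calc C₀ * (t - τ + ‖x - y‖ ^ 2) ^ (-((d + 1) / 2)) * ‖v τ y‖ * ‖u τ y‖
                    = C₀ * (t - τ + ‖x - y‖ ^ 2) ^ (-((d + 1) / 2)) * ‖u τ y‖ * ‖v τ y‖ := by ring
                  _ ≤ _ := hb
            _ = 2 * C₀ * (M₁ * M₂) * (t - τ + ‖x - y‖ ^ 2) ^ (-((d + 1) / 2)) := by ring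
      _ = ENNReal.ofReal (2 * C₀ * (M₁ * M₂)) * ENNReal.ofReal ((t - τ) ^ (d / 2 - (d + 1) / 2) * I) := by
          rw [lintegral_const_mul' _ _ ENNReal.ofReal_ne_top, lintegral_weight_sub_left,
            lintegral_add_norm_sq_rpow_neg he hσ]
      _ = ENNReal.ofReal (2 * C₀ * (M₁ * M₂) * I * (t - τ) ^ (-(1 / 2 : ℝ))) := by
          rw [← ENNReal.ofReal_mul (by positivity), hscal]
          ring_nf
  -- integrate in time
  calc ∫⁻ τ in Ioo s t, ∫⁻ y, ‖oseenKernel (t - τ) (x - y) (u τ y) (v τ y) +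
          oseenKernel (t - τ) (x - y) (v τ y) (u τ y)‖ₑ
      ≤ ∫⁻ τ in Ioo s t, ENNReal.ofReal (2 * C₀ * (M₁ * M₂) * I * (t - τ) ^ (-(1 / 2 : ℝ))) :=
        setLIntegral_mono' measurableSet_Ioo fun τ hτ => hslice τ hτ
    _ = ∫⁻ τ in Ioo s t, ENNReal.ofReal (2 * C₀ * (M₁ * M₂) * I) * ENNReal.ofReal ((t - τ) ^ (-(1 / 2 : ℝ))) := by
        refine setLIntegral_congr_fun measurableSet_Ioo fun τ _ => ?_
        rw [← ENNReal.ofReal_mul (by positivity)]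
    _ = ENNReal.ofReal (2 * C₀ * (M₁ * M₂) * I) * ENNReal.ofReal (2 * Real.sqrt (t - s)) := by
        rw [lintegral_const_mul' _ _ ENNReal.ofReal_ne_top, setLIntegral_Ioo_sub_rpow_neg_half_of_lt hst]
    _ = ENNReal.ofReal (2 * C₀ * I * (M₁ * M₂) * (2 * Real.sqrt (t - s))) := by
        rw [← ENNReal.ofReal_mul (by positivity)]
        ring_nf

/-! ### The Hölder modulus for an abstract restart identity -/

/-- **Space and time steps of the restart argument** (KNSS 2009, Lemma 4.1 / 6.1, abstract form): if
the slices `u t`, `t ∈ [a,b]`, are continuous and bounded by `m ≥ 0` and `u(t) = e^{(t−s)Δ}u(s) − N_s(t)`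
with `‖N_s(t)‖ ≤ L√(t−s)` (`a ≤ s < t ≤ b`), then for `t ∈ [a+1, b]` and a lag `0 < ε ≤ 1` (restart at
`t − ε`: `u(t) = A − B`, `A = e^{εΔ}u(t−ε)` `2^{d/2}ε^{-1/2}m`-Lipschitz, `‖B‖ ≤ L√ε`) the space step
`‖u(t,x') − u(t,x)‖ ≤ 2^{d/2}ε^{-1/2}m‖x'−x‖ + 2L√ε` and (restart at `t`, mollify the Lipschitz part) the
time step `‖u(t',x) − u(t,x)‖ ≤ (1 + 2·2^{d/2})(2^{d/2}ε^{-1/2}m)√(t'−t) + 2L√ε + L√(t'−t)` hold. Adapted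
from `exists_holder_quarter_of_oseenMild`. -/
theorem restart_space_time_moduli {u : ℝ → E → E} {N : ℝ → ℝ → E → E} {a b m L : ℝ} (hm : 0 ≤ m)
    (hcont : ∀ t ∈ Icc a b, Continuous (u t)) (hbd : ∀ t ∈ Icc a b, ∀ x, ‖u t x‖ ≤ m)
    (hN : ∀ s t : ℝ, a ≤ s → s < t → t ≤ b → ∀ x, ‖N s t x‖ ≤ L * Real.sqrt (t - s))
    (hmild : ∀ s t : ℝ, a ≤ s → s < t → t ≤ b → ∀ x,
      u t x = UnboundedOperators.heatExtension (u s) (t - s) x - N s t x)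
    {t : ℝ} (ht : t ∈ Icc (a + 1) b) {ε : ℝ} (hε : 0 < ε) (hε1 : ε ≤ 1) :
    (∀ x x', ‖u t x' - u t x‖ ≤
        (2 : ℝ) ^ ((Module.finrank ℝ E : ℝ) / 2) * ε ^ (-(1 / 2 : ℝ)) * m * ‖x' - x‖ + 2 * L * Real.sqrt ε) ∧
    (∀ t' ∈ Icc (a + 1) b, t < t' → ∀ x, ‖u t' x - u t x‖ ≤
        (1 + 2 * (2 : ℝ) ^ ((Module.finrank ℝ E : ℝ) / 2)) *
            ((2 : ℝ) ^ ((Module.finrank ℝ E : ℝ) / 2) * ε ^ (-(1 / 2 : ℝ)) * m) * (t' - t) ^ ((1 : ℝ) / 2) +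
          2 * L * Real.sqrt ε + L * Real.sqrt (t' - t)) := by
  set D : ℝ := (2 : ℝ) ^ ((Module.finrank ℝ E : ℝ) / 2) with hD
  have has : a ≤ t - ε := by linarith [ht.1]
  have hsI : t - ε ∈ Icc a b := ⟨has, by linarith [ht.2]⟩
  have htI : t ∈ Icc a b := ⟨by linarith [ht.1], ht.2⟩
  -- the decomposition `u t = A - B` at lag `ε`
  set A : E → E := UnboundedOperators.heatExtension (u (t - ε)) ε with hA
  have hrep : ∀ x, u t x = A x - N (t - ε) t x := fun x => by
    have h := hmild (t - ε) t has (by linarith) ht.2 x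
    rwa [sub_sub_cancel] at h
  have hlip : ∀ x x', ‖A x' - A x‖ ≤ D * ε ^ (-(1 / 2 : ℝ)) * m * ‖x' - x‖ := fun x x' =>
    norm_heatExtension_sub_le_mul_norm_sub_of_bound (hcont _ hsI) (hbd _ hsI) hε x x'
  have hAb : ∀ x, ‖A x‖ ≤ m := fun x => UnboundedOperators.norm_heatExtension_le_of_bound (hbd _ hsI) hε x
  have hBb : ∀ x, ‖N (t - ε) t x‖ ≤ L * Real.sqrt ε := fun x => by
    have h := hN (t - ε) t has (by linarith) ht.2 x
    rwa [sub_sub_cancel] at h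
  refine ⟨fun x x' => ?_, fun t' ht' htt' x => ?_⟩
  · -- space step
    rw [hrep x', hrep x]
    calc ‖A x' - N (t - ε) t x' - (A x - N (t - ε) t x)‖
        = ‖(A x' - A x) - (N (t - ε) t x' - N (t - ε) t x)‖ := by abel_nf
      _ ≤ ‖A x' - A x‖ + (‖N (t - ε) t x'‖ + ‖N (t - ε) t x‖) :=
          (norm_sub_le _ _).trans (add_le_add le_rfl (norm_sub_le _ _))
      _ ≤ D * ε ^ (-(1 / 2 : ℝ)) * m * ‖x' - x‖ + (L * Real.sqrt ε + L * Real.sqrt ε) :=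
          add_le_add (hlip x x') (add_le_add (hBb x') (hBb x))
      _ = _ := by ring
  · -- time step: restart at `t`, `u t = A - Bf` with `A` Lipschitz and `Bf` small, both continuous
    have hh : 0 < t' - t := sub_pos.2 htt'
    have hrep' : u t' x = UnboundedOperators.heatExtension (u t) (t' - t) x - N t t' x :=
      hmild t t' htI.1 htt' ht'.2 x
    set Bf : E → E := fun z => A z - u t z with hBf
    have hAc : Continuous A :=
      (UnboundedOperators.contDiff_heatExtension_of_bound (hcont _ hsI) (hbd _ hsI) hε (m := 0)).continuous
    have hBfc : Continuous Bf := hAc.sub (hcont t htI)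
    have hBfb : ∀ z, ‖Bf z‖ ≤ L * Real.sqrt ε := fun z => by
      have e : Bf z = N (t - ε) t z := by rw [hBf]; dsimp only; rw [hrep z]; abel
      rw [e]; exact hBb z
    have hut : u t = fun z => A z - Bf z := funext fun z => by rw [hBf]; dsimp only; abel
    have hsplit : UnboundedOperators.heatExtension (u t) (t' - t) x =
        UnboundedOperators.heatExtension A (t' - t) x - UnboundedOperators.heatExtension Bf (t' - t) x := by
      rw [hut]
      exact UnboundedOperators.heatExtension_sub_of_bound hAc hBfc hAb hBfb hh x
    -- the mollification error for the Lipschitz part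
    have hAlip : ∀ y z, ‖A y - A z‖ ≤ (D * ε ^ (-(1 / 2 : ℝ)) * m) * ‖y - z‖ ^ (1 : ℝ) :=
      fun y z => by rw [Real.rpow_one]; exact hlip z y
    have hLA : 0 ≤ D * ε ^ (-(1 / 2 : ℝ)) * m := by positivity
    have hmoll : ‖UnboundedOperators.heatExtension A (t' - t) x - A x‖ ≤
        (1 + 2 * D) * (D * ε ^ (-(1 / 2 : ℝ)) * m) * (t' - t) ^ ((1 : ℝ) / 2) :=
      UnboundedOperators.norm_heatExtension_sub_self_le_of_holder hAc hAb hLA zero_le_one le_rfl hAlip hh x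
    have hmollB : ‖UnboundedOperators.heatExtension Bf (t' - t) x‖ ≤ L * Real.sqrt ε :=
      UnboundedOperators.norm_heatExtension_le_of_bound hBfb hh x
    -- assemble
    rw [hrep', hsplit, show u t x = A x - Bf x from congrFun hut x]
    calc ‖UnboundedOperators.heatExtension A (t' - t) x - UnboundedOperators.heatExtension Bf (t' - t) x -
          N t t' x - (A x - Bf x)‖
        = ‖(UnboundedOperators.heatExtension A (t' - t) x - A x) -
            UnboundedOperators.heatExtension Bf (t' - t) x + Bf x - N t t' x‖ := by abel_nf
      _ ≤ ‖UnboundedOperators.heatExtension A (t' - t) x - A x‖ +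
            ‖UnboundedOperators.heatExtension Bf (t' - t) x‖ + ‖Bf x‖ + ‖N t t' x‖ :=
          (norm_sub_le _ _).trans (add_le_add ((norm_add_le _ _).trans
            (add_le_add (norm_sub_le _ _) le_rfl)) le_rfl)
      _ ≤ (1 + 2 * D) * (D * ε ^ (-(1 / 2 : ℝ)) * m) * (t' - t) ^ ((1 : ℝ) / 2) +
            L * Real.sqrt ε + L * Real.sqrt ε + L * Real.sqrt (t' - t) :=
          add_le_add (add_le_add (add_le_add hmoll hmollB) (hBfb x)) (hN t t' htI.1 htt' ht'.2 x)
      _ = _ := by ring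

/-- **Uniform `1/4`-Hölder modulus for an abstract restart identity** (the equicontinuity behind KNSS
2009, Lemma 4.1 / 6.1): there is `K₀ = K₀(E) > 0` such that every field `u : ℝ → E → E` with slices
continuous and bounded by `m ≥ 0` on `[a, b]` and `u(t) = e^{(t−s)Δ}u(s) − N_s(t)` for `a ≤ s < t ≤ b`,
`‖N_s(t)(x)‖ ≤ L√(t−s)`, `L ≥ 0`, obeys `‖u(t', x') − u(t, x)‖ ≤ K₀ (m + L) max(|t' − t|, ‖x' − x‖)^{1/4}`
for `t, t' ∈ [a + 1, b]` (space step at `t'`, time step at `x`, lag `ε = √δ`). Adapted from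
`exists_holder_quarter_of_oseenMild`. -/
theorem exists_holder_quarter_of_heat_restart :
    ∃ K₀ : ℝ, 0 < K₀ ∧ ∀ ⦃u : ℝ → E → E⦄ ⦃N : ℝ → ℝ → E → E⦄ ⦃a b m L : ℝ⦄, 0 ≤ m → 0 ≤ L →
      (∀ t ∈ Icc a b, Continuous (u t)) →
      (∀ t ∈ Icc a b, ∀ x, ‖u t x‖ ≤ m) →
      (∀ s t : ℝ, a ≤ s → s < t → t ≤ b → ∀ x, ‖N s t x‖ ≤ L * Real.sqrt (t - s)) →
      (∀ s t : ℝ, a ≤ s → s < t → t ≤ b → ∀ x,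
        u t x = UnboundedOperators.heatExtension (u s) (t - s) x - N s t x) →
      ∀ t ∈ Icc (a + 1) b, ∀ t' ∈ Icc (a + 1) b, ∀ x x' : E,
        ‖u t' x' - u t x‖ ≤ K₀ * (m + L) * (max |t' - t| ‖x' - x‖) ^ (1 / 4 : ℝ) := by
  set D : ℝ := (2 : ℝ) ^ ((Module.finrank ℝ E : ℝ) / 2) with hD
  set H : ℝ := 1 + 2 * (2 : ℝ) ^ ((Module.finrank ℝ E : ℝ) / 2) with hH
  have hD0 : 0 < D := by positivity
  have hH0 : 0 < H := by positivity
  refine ⟨D + H * D + 5, by positivity, ?_⟩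
  intro u N a b m L hm hL hcont hbd hN hmild
  -- ### the combination, for `t ≤ t'`
  have key : ∀ t ∈ Icc (a + 1) b, ∀ t' ∈ Icc (a + 1) b, t ≤ t' → ∀ x x' : E,
      ‖u t' x' - u t x‖ ≤ (D + H * D + 5) * (m + L) * (max |t' - t| ‖x' - x‖) ^ (1 / 4 : ℝ) := by
    intro t ht t' ht' htt' x x'
    set δ : ℝ := max |t' - t| ‖x' - x‖ with hδ
    have hδ0 : 0 ≤ δ := le_max_of_le_left (abs_nonneg _)
    have htI : t ∈ Icc a b := ⟨by linarith [ht.1], ht.2⟩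
    have ht'I : t' ∈ Icc a b := ⟨by linarith [ht'.1], ht'.2⟩
    have hDHL : 0 ≤ (D + H * D) * L := by positivity
    rcases hδ0.eq_or_lt with hδz | hδpos
    · -- `δ = 0`: same point
      have h1 : |t' - t| ≤ 0 := hδz ▸ le_max_left _ _
      have h2 : ‖x' - x‖ ≤ 0 := hδz ▸ le_max_right _ _
      have e1 : t' = t := by have := abs_nonpos_iff.1 h1; linarith
      have e2 : x' = x := sub_eq_zero.1 (norm_le_zero_iff.1 h2)
      subst e1; subst e2
      simp only [sub_self, norm_zero]
      positivity
    set c : ℝ := δ ^ (1 / 4 : ℝ) with hc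
    have hc0 : 0 < c := Real.rpow_pos_of_pos hδpos _
    have hδc : δ = c ^ 4 := by rw [hc, ← Real.rpow_natCast, ← Real.rpow_mul hδpos.le]; norm_num
    rcases le_or_gt δ 1 with hδ1 | hδ1
    · -- main case `0 < δ ≤ 1`: lag `ε = √δ = c²`
      have hc1 : c ≤ 1 := by rw [hc]; exact Real.rpow_le_one hδpos.le hδ1 (by norm_num)
      have hε0 : 0 < c ^ 2 := by positivity
      have hε1 : c ^ 2 ≤ 1 := by nlinarith
      have hεr : (c ^ 2) ^ (-(1 / 2 : ℝ)) = c⁻¹ := sq_rpow_neg_half_eq_inv hc0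
      have hsε : Real.sqrt (c ^ 2) = c := Real.sqrt_sq hc0.le
      have hsδ : Real.sqrt δ = c ^ 2 := by
        rw [hδc, show c ^ 4 = (c ^ 2) ^ 2 by ring, Real.sqrt_sq (by positivity)]
      have hc2 : c ^ 2 ≤ c := by nlinarith
      have hc3 : c ^ 3 ≤ c := by nlinarith
      obtain ⟨hsp, -⟩ := restart_space_time_moduli hm hcont hbd hN hmild ht' hε0 hε1
      obtain ⟨-, hti⟩ := restart_space_time_moduli hm hcont hbd hN hmild ht hε0 hε1
      -- space step at time `t'`
      have hxx : ‖x' - x‖ ≤ δ := le_max_right _ _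
      have h1 : ‖u t' x' - u t' x‖ ≤ D * m * c ^ 3 + 2 * L * c := by
        have h := hsp x x'
        rw [hεr, hsε] at h
        refine h.trans ?_
        have : D * c⁻¹ * m * ‖x' - x‖ ≤ D * c⁻¹ * m * δ := by gcongr
        have e : D * c⁻¹ * m * δ = D * m * c ^ 3 := by rw [hδc]; field_simp
        linarith
      -- time step at the point `x`
      have h2 : ‖u t' x - u t x‖ ≤ H * D * m * c + 2 * L * c + L * c ^ 2 := by
        rcases htt'.eq_or_lt with heq | hlt
        · subst heq; simp only [sub_self, norm_zero]; positivity
        · have h := hti t' ht' hlt x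
          rw [hεr, hsε] at h
          have hh : t' - t ≤ δ := (le_abs_self _).trans (le_max_left _ _)
          have hsh : Real.sqrt (t' - t) ≤ c ^ 2 := hsδ ▸ Real.sqrt_le_sqrt hh
          have hrh : (t' - t) ^ ((1 : ℝ) / 2) ≤ c ^ 2 := by rw [← Real.sqrt_eq_rpow]; exact hsh
          refine h.trans ?_
          have e1 : H * (D * c⁻¹ * m) * (t' - t) ^ ((1 : ℝ) / 2) ≤ H * (D * c⁻¹ * m) * c ^ 2 := by gcongr
          have e2 : H * (D * c⁻¹ * m) * c ^ 2 = H * D * m * c := by field_simp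
          have e3 : L * Real.sqrt (t' - t) ≤ L * c ^ 2 := by gcongr
          linarith
      -- combine: every power of `c` is at most `c`
      calc ‖u t' x' - u t x‖ = ‖(u t' x' - u t' x) + (u t' x - u t x)‖ := by rw [sub_add_sub_cancel]
        _ ≤ ‖u t' x' - u t' x‖ + ‖u t' x - u t x‖ := norm_add_le _ _
        _ ≤ (D * m * c ^ 3 + 2 * L * c) + (H * D * m * c + 2 * L * c + L * c ^ 2) := add_le_add h1 h2
        _ ≤ (D * m * c + 2 * L * c) + (H * D * m * c + 2 * L * c + L * c) := by
              have : D * m * c ^ 3 ≤ D * m * c := mul_le_mul_of_nonneg_left hc3 (by positivity)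
              have : L * c ^ 2 ≤ L * c := mul_le_mul_of_nonneg_left hc2 hL
              linarith
        _ = ((D + H * D) * m + 5 * L) * c := by ring
        _ ≤ (D + H * D + 5) * (m + L) * c := by
              apply mul_le_mul_of_nonneg_right _ hc0.le
              nlinarith [hDHL, hm]
    · -- `δ > 1`: the trivial bound
      have hc1 : 1 ≤ c := by rw [hc]; exact Real.one_le_rpow hδ1.le (by norm_num)
      have hDHmL : 0 ≤ (D + H * D) * (m + L) := by positivity
      calc ‖u t' x' - u t x‖ ≤ 2 * m :=
            (norm_sub_le _ _).trans (by linarith [hbd t' ht'I x', hbd t htI x])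
        _ ≤ (D + H * D + 5) * (m + L) * 1 := by nlinarith [hDHmL, hm, hL]
        _ ≤ (D + H * D + 5) * (m + L) * c := by gcongr
  -- ### symmetry in `(t, x) ↔ (t', x')`
  intro t ht t' ht' x x'
  rcases le_total t t' with h | h
  · exact key t ht t' ht' h x x'
  · have hk := key t' ht' t ht h x' x
    rwa [norm_sub_rev, abs_sub_comm, norm_sub_rev x] at hk

/-! ### The registered stub -/

/-- **Stub 3 (M) — uniform modulus on the cylinder.** About a drift `u` continuous on `t < 0` with
`‖u(t,x)‖ ≤ C/√(−t)`, every field `v`, smooth on `t < 0`, with tempered envelope constant `K`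
(`‖v(t,x)‖ ≤ K w(t)`) and obeying the linearised Oseen identity about `u`, is uniformly continuous on
`Q_R` with modulus `K ω(δ)`, `ω(δ) = c(C) δ^{1/4} → 0`: restart the identity at `t − ε` and at `t` (on
`[−3,−1]` the drift is bounded by `C` and the field by `2K`; the Duhamel term `B(u,v) + B(v,u)` over a
time span `ε` is `O(C K √ε)` by `exists_norm_oseenDuhamel_bounded_le` and bilinearity, the caloric term
is `2^{3/2} ε^{-1/2} (2K)`-Lipschitz by `norm_heatExtension_sub_le_mul_norm_sub_of_bound`, and
`e^{hΔ}g − g = O(Lip g · √h)`; choose `ε = √δ`) — the proof of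
`OseenMildHolder.exists_holder_quarter_of_oseenMild` run on the linearised identity. -/
theorem stub_equicontinuous : ∀ (C : ℝ) (u : ℝ → ℝ³ → ℝ³),
    ContDiffOn ℝ (⊤ : ℕ∞) (Function.uncurry u) (Set.Iio 0 ×ˢ Set.univ) → HasTypeITimeDecay C u →
    ∀ R : ℝ, 0 < R →
    ∃ om : ℝ → ℝ, Tendsto om (𝓝[>] 0) (𝓝 0) ∧
      ∀ (v : ℝ → ℝ³ → ℝ³) (K : ℝ),
        ContDiffOn ℝ (⊤ : ℕ∞) (Function.uncurry v) (Set.Iio 0 ×ˢ Set.univ) →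
        (∀ t < 0, ∀ x, ‖v t x‖ ≤ K * (1 / Real.sqrt (-t) + 1 / (-t))) →
        (∀ s t : ℝ, s < t → t < 0 → ∀ x, v t x = heatFlow (v s) (t - s) x -
          ∫ τ in Set.Ioo s t, ∫ y, (oseenKernel (t - τ) (x - y) (u τ y) (v τ y) +
            oseenKernel (t - τ) (x - y) (v τ y) (u τ y))) →
        ∀ p ∈ Set.Icc (-2 : ℝ) (-1) ×ˢ Metric.closedBall (0 : ℝ³) R,
          ∀ p' ∈ Set.Icc (-2 : ℝ) (-1) ×ˢ Metric.closedBall (0 : ℝ³) R,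
            ‖v p.1 p.2 - v p'.1 p'.2‖ ≤ K * om (dist p p') := by
  intro C u _hu hCu R _hR
  obtain ⟨K₀, hK₀, hA⟩ := exists_holder_quarter_of_heat_restart (E := ℝ³)
  obtain ⟨C₁, hC₁, hB⟩ := exists_norm_integral_oseenKernel_symm_le (E := ℝ³)
  -- `0 ≤ C`, from the decay hypothesis at `(t, x) = (-1, 0)`
  have hC0 : 0 ≤ C := by
    have h := hCu (-1) (by norm_num) 0
    simp only [neg_neg, Real.sqrt_one, div_one] at h
    exact (norm_nonneg _).trans h
  refine ⟨fun δ => K₀ * (2 + 4 * C₁ * C) * δ ^ (1 / 4 : ℝ), ?_, ?_⟩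
  · -- `ω → 0` at `0⁺`
    have h1 : Tendsto (fun δ : ℝ => δ ^ (1 / 4 : ℝ)) (𝓝 0) (𝓝 0) := by
      have h := (Real.continuousAt_rpow_const 0 (1 / 4 : ℝ) (Or.inr (by norm_num))).tendsto
      rwa [Real.zero_rpow (by norm_num)] at h
    have h2 := h1.const_mul (K₀ * (2 + 4 * C₁ * C))
    rw [mul_zero] at h2
    exact tendsto_nhdsWithin_of_tendsto_nhds h2
  · intro v K hv hvK hid p hp p' hp'
    -- `0 ≤ K`, from the envelope hypothesis at `(t, x) = (-1, 0)`
    have hK0 : 0 ≤ K := by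
      have h := (norm_nonneg _).trans (hvK (-1) (by norm_num) 0)
      simp only [neg_neg, Real.sqrt_one, div_one] at h
      linarith
    -- continuity of the slices on `[-3, -1]`
    have hcont : ∀ t ∈ Icc (-3 : ℝ) (-1), Continuous (v t) := fun t ht =>
      hv.continuousOn.comp_continuous (Continuous.prodMk_right t) fun x =>
        ⟨show t < 0 by linarith [ht.2], mem_univ _⟩
    -- the bound `2K` for the field on `[-3, -1]`
    have hbd : ∀ t ∈ Icc (-3 : ℝ) (-1), ∀ x, ‖v t x‖ ≤ 2 * K := by
      intro t ht x
      refine (hvK t (by linarith [ht.2]) x).trans ?_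
      have h1 : 1 / Real.sqrt (-t) ≤ 1 := div_le_self zero_le_one (Real.one_le_sqrt.2 (by linarith [ht.2]))
      have h2 : 1 / (-t) ≤ 1 := div_le_self zero_le_one (by linarith [ht.2])
      nlinarith
    -- the bound `C` for the drift on `(-3, -1)`
    have hubd : ∀ τ : ℝ, -3 ≤ τ → τ < -1 → ∀ y, ‖u τ y‖ ≤ C := fun τ _ hτ y =>
      (hCu τ (by linarith) y).trans (div_le_self hC0 (Real.one_le_sqrt.2 (by linarith)))
    -- the Duhamel bound `L √(t - s)`, `L = 4 C₁ C K`
    have hN : ∀ s t : ℝ, -3 ≤ s → s < t → t ≤ -1 → ∀ x : ℝ³,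
        ‖∫ τ in Set.Ioo s t, ∫ y, (oseenKernel (t - τ) (x - y) (u τ y) (v τ y) +
            oseenKernel (t - τ) (x - y) (v τ y) (u τ y))‖ ≤ 4 * C₁ * C * K * Real.sqrt (t - s) := by
      intro s t hs hst ht x
      have h := hB hst hC0 (by positivity : (0 : ℝ) ≤ 2 * K)
        (fun τ hτ y => hubd τ (hs.trans hτ.1.le) (lt_of_lt_of_le hτ.2 ht) y)
        (fun τ hτ y => hbd τ ⟨hs.trans hτ.1.le, hτ.2.le.trans ht⟩ y) x
      refine h.trans (le_of_eq ?_)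
      ring
    -- the restart identity on `[-3, -1]`
    have hmild : ∀ s t : ℝ, -3 ≤ s → s < t → t ≤ -1 → ∀ x : ℝ³,
        v t x = UnboundedOperators.heatExtension (v s) (t - s) x -
          ∫ τ in Set.Ioo s t, ∫ y, (oseenKernel (t - τ) (x - y) (u τ y) (v τ y) +
            oseenKernel (t - τ) (x - y) (v τ y) (u τ y)) := by
      intro s t _ hst ht x
      have h := hid s t hst (by linarith) x
      rwa [heatFlow_of_pos _ (sub_pos.2 hst)] at h
    have key := hA (u := v) (N := fun s t x => ∫ τ in Set.Ioo s t, ∫ y,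
        (oseenKernel (t - τ) (x - y) (u τ y) (v τ y) + oseenKernel (t - τ) (x - y) (v τ y) (u τ y)))
      (by positivity : (0 : ℝ) ≤ 2 * K) (by positivity : (0 : ℝ) ≤ 4 * C₁ * C * K) hcont hbd hN hmild
    obtain ⟨hp1, -⟩ := hp
    obtain ⟨hp1', -⟩ := hp'
    have h := key p'.1 ⟨by linarith [hp1'.1], hp1'.2⟩ p.1 ⟨by linarith [hp1.1], hp1.2⟩ p'.2 p.2
    show ‖v p.1 p.2 - v p'.1 p'.2‖ ≤ K * (K₀ * (2 + 4 * C₁ * C) * (dist p p') ^ (1 / 4 : ℝ))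
    rw [Prod.dist_eq, Real.dist_eq, dist_eq_norm]
    calc ‖v p.1 p.2 - v p'.1 p'.2‖
        ≤ K₀ * (2 * K + 4 * C₁ * C * K) * (max |p.1 - p'.1| ‖p.2 - p'.2‖) ^ (1 / 4 : ℝ) := h
      _ = _ := by ring

end Summit.NavierStokesRegularity.NavierStokesRegularity.Theorems

end
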